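import Summits.ResolutionOfSingularities.ResolutionOfSingularities.Theorems.EquisingularLiftEquisingularLiftNatNoseTowerBTriplePrimeSigmaPGOfFact
import Summits.ResolutionOfSingularities.ResolutionOfSingularities.Theorems.EquisingularLiftEquisingularLiftNatNoseCIRung
import Summits.ResolutionOfSingularities.ResolutionOfSingularities.Theorems.EquisingularLiftEquisingularLiftNatERoundLicence
import HarnessLib

/-!
# [OURS · L1 W4.5(b) · EL♮(3) · WIDTH TABLE D13 «(P-ram-Γ) / E-ROUND», rung row] RUNG^{ΣPG} `nose_secpg_rung_three` + its two HSUBⁱ suppliers HSUBᵈΣPG / HSUBᶜⁱΣPG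
# `(T-k) → p.Prime → ∀ k … → NoseHypHostedNestEquinodalDirectCISigmaPGBTriplePrime₂ k 3 H ι → ELNatConclusionO k 3 H ι` (binder = RUNGᶜⁱ's VERBATIM, variant (b))

res-L1-w45b-stub-2 g20, SCRATCH for res-L1-w45b-stub-4 g15 (desk DESK WORD g26-12 GO; stub-4's D12 layout, file (4); desk name `…NatNosePGRung` ∋
`nose_secpg_rung_three`, DESK WORD g26-7 (1) variant (b): licences discharged INSIDE).  = stub-4's draft `NoseSigmaRung.lean` cb72dba881155a00 with: the doors
`ReachDirect…Sigma₂ ↦ ReachDirect…SigmaPG₂` and blob `…DirectCISigmaBTriplePrime₂ ↦ …DirectCISigmaPGBTriplePrime₂` (✓ `…NatResidueHypDefsE7` p711287); the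
stage twin `directNose_stage_zero_of_model_sigmaPG` (`…NatNoseTowerBTriplePrimeSigmaPGOfFact`, same module as the hsub); the rung's Σ-licence binder REMOVED and discharged INSIDE by a local `have` derived from ★ `ERound.eRoundLift` (✓ p710420; `𝓙 := 𝓘⟨E⟩`,
`𝓘 := 𝓘⟨Z⟩` — the same statement as res-L1-w45b-nose-w1's ✓ `SecCurve.secCurveLift k` p710150, whose module this file deliberately does NOT import: its hub
olean is lost, desk ASK (0) 11:18Z); the (P-ram-Γ) licence is the theorem ★ `ERound.eRoundLift`, used inside
★★ `Tower.towerPRamGamma_invB₁_FE`.  (εΣPG) `Direct.hsubd_sigmaPG_of_smoothing`, (ε″ΣPG) `Direct.hsubci_sigmaPG_of_smoothing`, (ζΣPG) ★ `nose_secpg_rung_three`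
= ONE application of ✓ K5ⁱ `target_elnat_of_hostedSubchainResolutionᵢ` with `ReachI := (ReachEquinodalPlanarNose₂ ∨ ReachDirectPlanarNoseSigmaPG₂) ∨
ReachDirectCINoseSigmaPG₂`.  OURS; NOT a statement of any manuscript ([Hironaka2017] is a candidate under adjudication, nothing of it is asserted);
AI-written, weaker than expert review.  No `sorry`; standard axioms; DEF-FREE; the ONLY hypothesis is (T-k) `EmbeddedCurveLiftFact` (the registered
`stub_elnat_embeddedCurveLiftFact`).  `--supports stmt-ResolutionOfSingularities-20148 --as helper`, counted 0.  EL♮(3) is NOT proved here: after the D13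
REPLACE the nose residue reads `¬ NoseHypHostedNestEquinodalDirectCISigmaPGBTriplePrime₂`.  [folklore; pure composition]
-/

set_option linter.dupNamespace false -- mandated namespace `Summit.<Summit>.<Problem>` of this single-conjunct summit
set_option linter.overlappingInstances false -- signatures carry `[IsDomain O] [IsDiscreteValuationRing O]`

noncomputable section

open CategoryTheory CategoryTheory.Limits AlgebraicGeometry TopologicalSpace Topology IsLocalRing
open MvPolynomial
open Literature.AlgebraicGeometry.Resolution
open AlgebraicGeometry.Scheme.IdealSheafData
open Summit.ResolutionOfSingularities.ResolutionOfSingularities.Theses.EquisingularLift.Split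
open Summit.ResolutionOfSingularities.ResolutionOfSingularities.Cruxes.EquisingularLift.StrataSplit

namespace Summit.ResolutionOfSingularities.ResolutionOfSingularities.Cruxes.EquisingularLiftNat.Sections.Direct

/-- ★ **HSUBᵈΣ — the K5ⁱ HSUBⁱ slot at the D12 door `ReachDirectPlanarNoseSigmaPG₂ k 3 ℓ (range ι)`** = ✓ `Direct.hsubd_of_smoothing` (p704964) VERBATIM with the
door's Σ tail (one more antecedent `TowerSecRoundSigma … R →` in the `∀R` clause), ONE more hypothesis (the Σ-licence at `(O, k, θ)`) and the last call
re-pointed to `Equinodal.directNose_stage_zero_of_model_sigmaPG`. [OURS · L1 W4.5b · WIDTH TABLE D12 engine delta (εΣ), desk R74 (i); EL♮(3) NOT proved] -/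
theorem hsubd_sigmaPG_of_smoothing (hF : EmbeddedCurveLiftFact) (k : Type) [Field k] [IsAlgClosed k] (H : Scheme.{0})
    (ι : H ⟶ (Literature.AlgebraicGeometry.Motives.projectiveSpace 3 k).left)
    (hι : AlgebraicGeometry.IsClosedImmersion ι) (hH : AlgebraicGeometry.IsIntegral H)
    (E₀ : Set (Literature.AlgebraicGeometry.Motives.projectiveSpace 3 k).left)
    (hE₀' : letI := MvPolynomial.gradedAlgebra (σ := Fin (3 + 1)) (R := k)
      E₀ = ∅ ∨ ∃ ℓ₀ : MvPolynomial (Fin (3 + 1)) k, ℓ₀.IsHomogeneous 1 ∧ ℓ₀ ≠ 0 ∧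
        E₀ = {y : (Literature.AlgebraicGeometry.Motives.projectiveSpace 3 k).left | ℓ₀ ∈ (y : ProjectiveSpectrum (MvPolynomial.homogeneousSubmodule (Fin (3 + 1)) k)).asHomogeneousIdeal}) :
    ∀ (O : Type) [CommRing O] [IsDomain O] [IsDiscreteValuationRing O] [IsAdicComplete (IsLocalRing.maximalIdeal O) O] [IsAlgClosed (IsLocalRing.ResidueField O)] (θ : O →+* k), Function.Surjective θ →
      -- the Σ-LICENCE at `(O, k, θ)` (res-L1-w45b-stub-2's binder 0196e0c85d2c112d; WIDTH TABLE D12)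
      (∀ {P : Scheme.{0}} (X : Scheme.{0}) (σ : X ⟶ P) (q : P ⟶ Spec (.of O)) (𝓔 : X.IdealSheafData),
        IsIntegral X → IsLocallyNoetherian X → Scheme.IsRegular X → IsProper (σ ≫ q) →
        (∀ x : X, (stalkIdeal 𝓔 x).IsPrincipal) → 𝓔 ≠ ⊥ →
        Scheme.IsRegular 𝓔.subscheme → Flat (𝓔.subschemeι ≫ σ ≫ q) → IsProper (𝓔.subschemeι ≫ σ ≫ q) →
        ∀ (G : Scheme.{0}) (j : G ⟶ X) (t : G ⟶ Spec (.of k)),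
          IsPullback j t (σ ≫ q) (Spec.map (CommRingCat.ofHom θ)) →
          ∀ (E : Set G) (hE : IsClosed E), 𝓔.comap j = vanishingIdeal (⟨E, hE⟩ : Closeds G) →
          ∀ (Z : Set G) (hZ : IsClosed Z), Z ⊆ E →
            Set.Finite {x : ↥(redSub G Z hZ) | ¬ IsRegularLocalRing ((redSub G Z hZ).presheaf.stalk x)} →
            (∀ z : ↥(redSub G Z hZ), IsClosed ({z} : Set ↥(redSub G Z hZ)) →
              ringKrullDim ((redSub G Z hZ).presheaf.stalk z) = ((1 : ℕ) : WithBot ℕ∞)) →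
            (∀ (i : redSub G Z hZ ⟶ redSub G E hE), i ≫ redSubι G E hE = redSubι G Z hZ →
              ∀ z : ↥(redSub G Z hZ), IsClosed ({z} : Set ↥(redSub G Z hZ)) →
                ringKrullDim ((redSub G E hE).presheaf.stalk (i z)) = ((2 : ℕ) : WithBot ℕ∞)) →
            (∀ z ∈ Z, IsClosed ({z} : Set G) → ∃ f : G.presheaf.stalk z,
              stalkIdeal (vanishingIdeal (⟨Z, hZ⟩ : Closeds G)) z =
                  stalkIdeal (vanishingIdeal (⟨E, hE⟩ : Closeds G)) z ⊔ Ideal.span {f} ∧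
                f ∉ stalkIdeal (vanishingIdeal (⟨E, hE⟩ : Closeds G)) z ⊔ (maximalIdeal (G.presheaf.stalk z)) ^ 2) →
            DirStepUnobs G E hE Z hZ →
            ∃ C : X.IdealSheafData, 𝓔 ≤ C ∧ Scheme.IsRegular C.subscheme ∧ Flat (C.subschemeι ≫ σ ≫ q) ∧
              C.comap j = vanishingIdeal (⟨Z, hZ⟩ : Closeds G)) →
      (letI := MvPolynomial.gradedAlgebra (σ := Fin (3 + 1)) (R := O); letI := MvPolynomial.gradedAlgebra (σ := Fin (3 + 1)) (R := k);
       ∀ (φ : MvPolynomial.homogeneousSubmodule (Fin (3 + 1)) O →+*ᵍ MvPolynomial.homogeneousSubmodule (Fin (3 + 1)) k)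
        (hφ' : HomogeneousIdeal.irrelevant (MvPolynomial.homogeneousSubmodule (Fin (3 + 1)) k) ≤ (HomogeneousIdeal.irrelevant (MvPolynomial.homogeneousSubmodule (Fin (3 + 1)) O)).map φ), (∀ s, φ s = MvPolynomial.map θ s) →
      ∀ (Ch : ∀ X' : AlgebraicGeometry.Scheme.{0}, (X' ⟶ (AlgebraicGeometry.Proj (MvPolynomial.homogeneousSubmodule (Fin (3 + 1)) O))) → Set X' → Prop),
        (∀ (X' X'' : AlgebraicGeometry.Scheme.{0}) (σ' : X' ⟶ (AlgebraicGeometry.Proj (MvPolynomial.homogeneousSubmodule (Fin (3 + 1)) O))) (S' : Set X') (C : X'.IdealSheafData) (τ : X'' ⟶ X'), Ch X' σ' S' → Literature.AlgebraicGeometry.Resolution.IsBlowup τ C →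
          Literature.AlgebraicGeometry.Resolution.Scheme.IsRegular C.subscheme → AlgebraicGeometry.Flat (C.subschemeι ≫ σ' ≫ (AlgebraicGeometry.Proj.toSpecZero (MvPolynomial.homogeneousSubmodule (Fin (3 + 1)) O) ≫ AlgebraicGeometry.Spec.map (CommRingCat.ofHom (algebraMap O (MvPolynomial.homogeneousSubmodule (Fin (3 + 1)) O 0))))) → σ' '' (C.support : Set X') ⊆ {y | ¬ IsGenericPoint y (Set.range (ι ≫ AlgebraicGeometry.Proj.map φ hφ' : H ⟶ (AlgebraicGeometry.Proj (MvPolynomial.homogeneousSubmodule (Fin (3 + 1)) O))))} →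
          (C.support : Set X') ∩ (σ' ≫ (AlgebraicGeometry.Proj.toSpecZero (MvPolynomial.homogeneousSubmodule (Fin (3 + 1)) O) ≫ AlgebraicGeometry.Spec.map (CommRingCat.ofHom (algebraMap O (MvPolynomial.homogeneousSubmodule (Fin (3 + 1)) O 0))))) ⁻¹' {IsLocalRing.closedPoint O} ⊆ S' → Ch X'' (τ ≫ σ') (closure (τ ⁻¹' (S' \ (C.support : Set X'))))) → (∀ (X' : AlgebraicGeometry.Scheme.{0}) (σ' : X' ⟶ (AlgebraicGeometry.Proj (MvPolynomial.homogeneousSubmodule (Fin (3 + 1)) O))) (S' : Set X'), Ch X' σ' S' →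
          Summit.ResolutionOfSingularities.ResolutionOfSingularities.Theses.EquisingularLift.Split.Chain (AlgebraicGeometry.Proj (MvPolynomial.homogeneousSubmodule (Fin (3 + 1)) O)) (Set.range (ι ≫ AlgebraicGeometry.Proj.map φ hφ' : H ⟶ (AlgebraicGeometry.Proj (MvPolynomial.homogeneousSubmodule (Fin (3 + 1)) O)))) X' σ' S') → (Set.range (ι ≫ AlgebraicGeometry.Proj.map φ hφ' : H ⟶ (AlgebraicGeometry.Proj (MvPolynomial.homogeneousSubmodule (Fin (3 + 1)) O)))) ⊆ (AlgebraicGeometry.Proj.toSpecZero (MvPolynomial.homogeneousSubmodule (Fin (3 + 1)) O) ≫ AlgebraicGeometry.Spec.map (CommRingCat.ofHom (algebraMap O (MvPolynomial.homogeneousSubmodule (Fin (3 + 1)) O 0)))) ⁻¹' {IsLocalRing.closedPoint O} → IsIrreducible (Set.range (ι ≫ AlgebraicGeometry.Proj.map φ hφ' : H ⟶ (AlgebraicGeometry.Proj (MvPolynomial.homogeneousSubmodule (Fin (3 + 1)) O)))) → IsClosed (Set.range (ι ≫ AlgebraicGeometry.Proj.map φ hφ' : H ⟶ (AlgebraicGeometry.Proj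 (MvPolynomial.homogeneousSubmodule (Fin (3 + 1)) O)))) →
        AlgebraicGeometry.IsIntegral (AlgebraicGeometry.Proj (MvPolynomial.homogeneousSubmodule (Fin (3 + 1)) O)) → IsLocallyNoetherian (AlgebraicGeometry.Proj (MvPolynomial.homogeneousSubmodule (Fin (3 + 1)) O)) → Literature.AlgebraicGeometry.Resolution.Scheme.IsRegular (AlgebraicGeometry.Proj (MvPolynomial.homogeneousSubmodule (Fin (3 + 1)) O)) → AlgebraicGeometry.IsProper (AlgebraicGeometry.Proj.toSpecZero (MvPolynomial.homogeneousSubmodule (Fin (3 + 1)) O) ≫ AlgebraicGeometry.Spec.map (CommRingCat.ofHom (algebraMap O (MvPolynomial.homogeneousSubmodule (Fin (3 + 1)) O 0)))) → AlgebraicGeometry.SmoothOfRelativeDimension 3 (AlgebraicGeometry.Proj.toSpecZero (MvPolynomial.homogeneousSubmodule (Fin (3 + 1)) O) ≫ AlgebraicGeometry.Spec.map (CommRingCat.ofHom (algebraMap O (MvPolynomial.homogeneousSubmodule (Fin (3 + 1)) O 0)))) →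
      -- the INITIAL stage and the initial host's model
      Ch (AlgebraicGeometry.Proj (MvPolynomial.homogeneousSubmodule (Fin (3 + 1)) O)) (𝟙 (AlgebraicGeometry.Proj (MvPolynomial.homogeneousSubmodule (Fin (3 + 1)) O))) (Set.range (ι ≫ AlgebraicGeometry.Proj.map φ hφ' : H ⟶ (AlgebraicGeometry.Proj (MvPolynomial.homogeneousSubmodule (Fin (3 + 1)) O)))) →
      TCPlus.LetterDatum O (AlgebraicGeometry.Proj (MvPolynomial.homogeneousSubmodule (Fin (3 + 1)) O)) (AlgebraicGeometry.Proj.toSpecZero (MvPolynomial.homogeneousSubmodule (Fin (3 + 1)) O) ≫ AlgebraicGeometry.Spec.map (CommRingCat.ofHom (algebraMap O (MvPolynomial.homogeneousSubmodule (Fin (3 + 1)) O 0)))) (Set.range (ι ≫ AlgebraicGeometry.Proj.map φ hφ' : H ⟶ (AlgebraicGeometry.Proj (MvPolynomial.homogeneousSubmodule (Fin (3 + 1)) O)))) (Literature.AlgebraicGeometry.Motives.projectiveSpace 3 k).left (AlgebraicGeometry.Proj (MvPolynomial.homogeneousSubmodule (Fin (3 + 1)) O)) (𝟙 (AlgebraicGeometry.Proj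 (MvPolynomial.homogeneousSubmodule (Fin (3 + 1)) O))) (AlgebraicGeometry.Proj.map φ hφ' : (Literature.AlgebraicGeometry.Motives.projectiveSpace 3 k).left ⟶ (AlgebraicGeometry.Proj (MvPolynomial.homogeneousSubmodule (Fin (3 + 1)) O))) E₀ →
      ∀ (ℓ : MvPolynomial (Fin (3 + 1)) k) (F₉ : AlgebraicGeometry.Scheme.{0}) (β : F₉ ⟶ (Literature.AlgebraicGeometry.Motives.projectiveSpace 3 k).left) (T₉ E₉ : Set F₉),
        E₀ = {y : (Literature.AlgebraicGeometry.Motives.projectiveSpace 3 k).left | ℓ ∈ (y : ProjectiveSpectrum (MvPolynomial.homogeneousSubmodule (Fin (3 + 1)) k)).asHomogeneousIdeal} →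
        ReachDirectPlanarNoseSigmaPG₂ k 3 ℓ (Set.range ι) F₉ β T₉ E₉ →
        ∃ (X₉ : AlgebraicGeometry.Scheme.{0}) (σ₉ : X₉ ⟶ (AlgebraicGeometry.Proj (MvPolynomial.homogeneousSubmodule (Fin (3 + 1)) O))) (S₉ : Set X₉) (j₉ : F₉ ⟶ X₉) (t₉ : F₉ ⟶ AlgebraicGeometry.Spec (.of k)),
          Ch X₉ σ₉ S₉ ∧ AlgebraicGeometry.IsIntegral X₉ ∧ IsLocallyNoetherian X₉ ∧ Literature.AlgebraicGeometry.Resolution.Scheme.IsRegular X₉ ∧ AlgebraicGeometry.IsDominant (σ₉ ≫ (AlgebraicGeometry.Proj.toSpecZero (MvPolynomial.homogeneousSubmodule (Fin (3 + 1)) O) ≫ AlgebraicGeometry.Spec.map (CommRingCat.ofHom (algebraMap O (MvPolynomial.homogeneousSubmodule (Fin (3 + 1)) O 0))))) ∧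
          IsPullback j₉ t₉ (σ₉ ≫ (AlgebraicGeometry.Proj.toSpecZero (MvPolynomial.homogeneousSubmodule (Fin (3 + 1)) O) ≫ AlgebraicGeometry.Spec.map (CommRingCat.ofHom (algebraMap O (MvPolynomial.homogeneousSubmodule (Fin (3 + 1)) O 0))))) (AlgebraicGeometry.Spec.map (CommRingCat.ofHom θ)) ∧ j₉ '' T₉ = S₉ ∧ IsClosed T₉ ∧ IsIrreducible T₉ ∧ AlgebraicGeometry.IsIntegral F₉ ∧
          TCPlus.LetterDatum O (AlgebraicGeometry.Proj (MvPolynomial.homogeneousSubmodule (Fin (3 + 1)) O)) (AlgebraicGeometry.Proj.toSpecZero (MvPolynomial.homogeneousSubmodule (Fin (3 + 1)) O) ≫ AlgebraicGeometry.Spec.map (CommRingCat.ofHom (algebraMap O (MvPolynomial.homogeneousSubmodule (Fin (3 + 1)) O 0)))) (Set.range (ι ≫ AlgebraicGeometry.Proj.map φ hφ' : H ⟶ (AlgebraicGeometry.Proj (MvPolynomial.homogeneousSubmodule (Fin (3 + 1)) O)))) F₉ X₉ σ₉ j₉ E₉) := by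
  classical
  intro O _ _ _ _ _ θ hθ hSL
  letI := MvPolynomial.gradedAlgebra (σ := Fin (3 + 1)) (R := O)
  letI := MvPolynomial.gradedAlgebra (σ := Fin (3 + 1)) (R := k)
  intro φ hφ' hφ Ch hChStep hChSplit hYsp hYirr hYcl hPint hPnoeth hPreg hqprop hqsm hCh₀ h𝓔₀ ℓ F₉ β T₉ E₉ hE hR
  obtain ⟨hE₉, Z, hZ, hZT, hTZ, hZinf, hZℓ, hZirr, hZdim, hGreg, hEreg, hEdim, hN1, ⟨e, g, B, r, hge, hgsq, hZeq, hℓB, hr, hdet⟩,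
    F₃, υ', hυ', γ', E', Es', Ns', K', htail, -⟩ := hR
  subst hE₉
  subst hE
  -- (1) the host's LINEAR normal form: `ℓ₀` from the engine, `λ = θ L̃` from the door's hyperplane coordinates
  obtain ⟨ℓ₀, hℓ₀1, hℓ₀0, hV₀⟩ : ∃ ℓ₀ : MvPolynomial (Fin (3 + 1)) k, ℓ₀.IsHomogeneous 1 ∧ ℓ₀ ≠ 0 ∧
      {y : (Literature.AlgebraicGeometry.Motives.projectiveSpace 3 k).left |
          ℓ ∈ (y : ProjectiveSpectrum (MvPolynomial.homogeneousSubmodule (Fin (3 + 1)) k)).asHomogeneousIdeal} =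
        {y : (Literature.AlgebraicGeometry.Motives.projectiveSpace 3 k).left |
          ℓ₀ ∈ (y : ProjectiveSpectrum (MvPolynomial.homogeneousSubmodule (Fin (3 + 1)) k)).asHomogeneousIdeal} := by
    rcases hE₀' with h0 | ⟨ℓ₀, h1, h2, h3⟩
    · exfalso
      obtain ⟨z, hz⟩ := hZinf.nonempty
      have : z ∈ (∅ : Set (Literature.AlgebraicGeometry.Motives.projectiveSpace 3 k).left) := by rw [← h0]; exact hZℓ hz
      exact this
    · exact ⟨ℓ₀, h1, h2, h3⟩
  have hunit : ∀ x : O, θ x ≠ 0 → IsUnit x := by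
    intro x hx
    by_contra h
    have hm : x ∈ IsLocalRing.maximalIdeal O := h
    rw [← IsLocalRing.eq_maximalIdeal (RingHom.ker_isMaximal_of_surjective θ hθ)] at hm
    exact hx hm
  obtain ⟨a₀, Bt, ct, Nt, -, -, -, hcta₀, -, -, -, hψk, hkerk⟩ :=
    Equinodal.HyperplaneLift.exists_hyperplane_lift θ hθ hunit B r hr hdet
  have hdvd : (∑ a', C (θ (ct a')) * X a' : MvPolynomial (Fin (3 + 1)) k) ∣ ℓ := hkerk ℓ hℓB
  have hV := Equinodal.HostNormalForm.setOf_mem_eq_setOf_mem_linear (r := 2) (fun a' => θ (ct a')) a₀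
    (by simp only [hcta₀, map_one]) ℓ hdvd ℓ₀ hℓ₀1 hℓ₀0 hV₀
  have hL1 : (∑ a', C (θ (ct a')) * X a' : MvPolynomial (Fin (3 + 1)) k).IsHomogeneous 1 :=
    Equinodal.HyperplaneAlg.isHomogeneous_sum_C_mul_X _ id
  have hL0 : (∑ a', C (θ (ct a')) * X a' : MvPolynomial (Fin (3 + 1)) k) ≠ 0 := by
    intro h
    have h1 := Equinodal.HyperplaneLift.coeff_single_sum_C_mul_X (fun a' => θ (ct a')) a₀
    rw [h, coeff_zero, hcta₀, map_one] at h1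
    exact zero_ne_one h1
  -- the door's `Z`, host clause and hyperplane equation in terms of `λ` (door spelling of the point sets)
  have hAB : {y : (Literature.AlgebraicGeometry.Motives.projectiveSpace 3 k).left |
        ℓ ∈ (y : ProjectiveSpectrum (MvPolynomial.homogeneousSubmodule (Fin (3 + 1)) k)).asHomogeneousIdeal} =
      {y : (Literature.AlgebraicGeometry.Motives.projectiveSpace 3 k).left |
        (∑ a', C (θ (ct a')) * X a' : MvPolynomial (Fin (3 + 1)) k) ∈
          (y : ProjectiveSpectrum (MvPolynomial.homogeneousSubmodule (Fin (3 + 1)) k)).asHomogeneousIdeal} :=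
    Set.ext fun y => Set.ext_iff.mp hV y
  have hZeq' : Z = {y : (Literature.AlgebraicGeometry.Motives.projectiveSpace 3 k).left |
      (∑ a', C (θ (ct a')) * X a' : MvPolynomial (Fin (3 + 1)) k) ∈ (y : ProjectiveSpectrum (MvPolynomial.homogeneousSubmodule (Fin (3 + 1)) k)).asHomogeneousIdeal ∧
      g ∈ (y : ProjectiveSpectrum (MvPolynomial.homogeneousSubmodule (Fin (3 + 1)) k)).asHomogeneousIdeal} := by
    rw [hZeq]
    ext y
    have hy := Set.ext_iff.mp hAB y
    simp only [Set.mem_setOf_eq] at hy ⊢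
    rw [hy]
  -- transport of the «host regular along Z̃» clause along `V₊ℓ = V₊λ` (by `subst` on a generalised set; `rw` cannot, the closure proof is frozen)
  have hEregT : ∀ (S₁ S₂ : Set (Literature.AlgebraicGeometry.Motives.projectiveSpace 3 k).left) (hS : S₁ = S₂) (h₁ : IsClosed (closure S₁))
      (h₂ : IsClosed (closure S₂)),
      (∀ (i : redSub (Literature.AlgebraicGeometry.Motives.projectiveSpace 3 k).left Z hZ ⟶ redSub (Literature.AlgebraicGeometry.Motives.projectiveSpace 3 k).left (closure S₁) h₁),
        i ≫ redSubι (Literature.AlgebraicGeometry.Motives.projectiveSpace 3 k).left (closure S₁) h₁ = redSubι (Literature.AlgebraicGeometry.Motives.projectiveSpace 3 k).left Z hZ →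
        ∀ z : ↥(redSub (Literature.AlgebraicGeometry.Motives.projectiveSpace 3 k).left Z hZ),
          IsRegularLocalRing ((redSub (Literature.AlgebraicGeometry.Motives.projectiveSpace 3 k).left (closure S₁) h₁).presheaf.stalk (i.base z))) →
      (∀ (i : redSub (Literature.AlgebraicGeometry.Motives.projectiveSpace 3 k).left Z hZ ⟶ redSub (Literature.AlgebraicGeometry.Motives.projectiveSpace 3 k).left (closure S₂) h₂),
        i ≫ redSubι (Literature.AlgebraicGeometry.Motives.projectiveSpace 3 k).left (closure S₂) h₂ = redSubι (Literature.AlgebraicGeometry.Motives.projectiveSpace 3 k).left Z hZ →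
        ∀ z : ↥(redSub (Literature.AlgebraicGeometry.Motives.projectiveSpace 3 k).left Z hZ),
          IsRegularLocalRing ((redSub (Literature.AlgebraicGeometry.Motives.projectiveSpace 3 k).left (closure S₂) h₂).presheaf.stalk (i.base z))) := by
    intro S₁ S₂ hS h₁ h₂ hreg; subst hS; exact hreg
  replace hEreg := hEregT _ _ hAB _ isClosed_closure hEreg
  -- (2) THE CENTRE: res-L1-w45b-stub-2's explicit smoothing of the planar trace
  obtain ⟨C₀, hCreg, hCfl, hCj⟩ := Equinodal.planar_trace_smoothing k O θ hθ φ hφ' hφ hPnoeth hPreg hqprop _ hL1 hL0 Z hZ hEreg hN1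
    e g B r hge hgsq hZeq' hψk hr hdet
  -- (3) the move upstairs: res-L1-w45b-nose-w1's ✓ `directNose_stage_zero_of_model` (= stage-0 HEND block from the model `C₀`, then PHASE 2 of ✓ `hsube_of_suppliers`)
  exact Equinodal.directNose_stage_zero_of_model_sigmaPG hF k H ι hι hH O θ hθ hSL φ hφ' hφ Ch hChStep hChSplit hYsp hYirr hYcl hPint hPnoeth hPreg hqprop hqsm hCh₀
    Z hZ hZT hTZ hZinf hZdim C₀ hCreg hCfl hCj F₃ υ' hυ' F₉ γ' T₉ E' Es' Ns' K' htail

/-- ★ **HSUBᶜⁱΣ — the K5ⁱ HSUBⁱ slot at the D12 door `ReachDirectCINoseSigmaPG₂ k 3 (range ι)`** = ✓ `Direct.hsubci_of_smoothing` (p706892) VERBATIM with the Σ tail,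
the Σ-licence hypothesis and `directNose_stage_zero_of_model_sigmaPG`. [OURS · L1 W4.5b · WIDTH TABLE D12 engine delta (ε″Σ), desk R74 (i); EL♮(3) NOT proved] -/
theorem hsubci_sigmaPG_of_smoothing (hF : EmbeddedCurveLiftFact) (k : Type) [Field k] [IsAlgClosed k] (H : Scheme.{0})
    (ι : H ⟶ (Literature.AlgebraicGeometry.Motives.projectiveSpace 3 k).left)
    (hι : AlgebraicGeometry.IsClosedImmersion ι) (hH : AlgebraicGeometry.IsIntegral H)
    (E₀ : Set (Literature.AlgebraicGeometry.Motives.projectiveSpace 3 k).left) :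
    ∀ (O : Type) [CommRing O] [IsDomain O] [IsDiscreteValuationRing O] [IsAdicComplete (IsLocalRing.maximalIdeal O) O] [IsAlgClosed (IsLocalRing.ResidueField O)] (θ : O →+* k), Function.Surjective θ →
      -- the Σ-LICENCE at `(O, k, θ)` (res-L1-w45b-stub-2's binder 0196e0c85d2c112d; WIDTH TABLE D12)
      (∀ {P : Scheme.{0}} (X : Scheme.{0}) (σ : X ⟶ P) (q : P ⟶ Spec (.of O)) (𝓔 : X.IdealSheafData),
        IsIntegral X → IsLocallyNoetherian X → Scheme.IsRegular X → IsProper (σ ≫ q) →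
        (∀ x : X, (stalkIdeal 𝓔 x).IsPrincipal) → 𝓔 ≠ ⊥ →
        Scheme.IsRegular 𝓔.subscheme → Flat (𝓔.subschemeι ≫ σ ≫ q) → IsProper (𝓔.subschemeι ≫ σ ≫ q) →
        ∀ (G : Scheme.{0}) (j : G ⟶ X) (t : G ⟶ Spec (.of k)),
          IsPullback j t (σ ≫ q) (Spec.map (CommRingCat.ofHom θ)) →
          ∀ (E : Set G) (hE : IsClosed E), 𝓔.comap j = vanishingIdeal (⟨E, hE⟩ : Closeds G) →
          ∀ (Z : Set G) (hZ : IsClosed Z), Z ⊆ E →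
            Set.Finite {x : ↥(redSub G Z hZ) | ¬ IsRegularLocalRing ((redSub G Z hZ).presheaf.stalk x)} →
            (∀ z : ↥(redSub G Z hZ), IsClosed ({z} : Set ↥(redSub G Z hZ)) →
              ringKrullDim ((redSub G Z hZ).presheaf.stalk z) = ((1 : ℕ) : WithBot ℕ∞)) →
            (∀ (i : redSub G Z hZ ⟶ redSub G E hE), i ≫ redSubι G E hE = redSubι G Z hZ →
              ∀ z : ↥(redSub G Z hZ), IsClosed ({z} : Set ↥(redSub G Z hZ)) →
                ringKrullDim ((redSub G E hE).presheaf.stalk (i z)) = ((2 : ℕ) : WithBot ℕ∞)) →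
            (∀ z ∈ Z, IsClosed ({z} : Set G) → ∃ f : G.presheaf.stalk z,
              stalkIdeal (vanishingIdeal (⟨Z, hZ⟩ : Closeds G)) z =
                  stalkIdeal (vanishingIdeal (⟨E, hE⟩ : Closeds G)) z ⊔ Ideal.span {f} ∧
                f ∉ stalkIdeal (vanishingIdeal (⟨E, hE⟩ : Closeds G)) z ⊔ (maximalIdeal (G.presheaf.stalk z)) ^ 2) →
            DirStepUnobs G E hE Z hZ →
            ∃ C : X.IdealSheafData, 𝓔 ≤ C ∧ Scheme.IsRegular C.subscheme ∧ Flat (C.subschemeι ≫ σ ≫ q) ∧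
              C.comap j = vanishingIdeal (⟨Z, hZ⟩ : Closeds G)) →
      (letI := MvPolynomial.gradedAlgebra (σ := Fin (3 + 1)) (R := O); letI := MvPolynomial.gradedAlgebra (σ := Fin (3 + 1)) (R := k);
       ∀ (φ : MvPolynomial.homogeneousSubmodule (Fin (3 + 1)) O →+*ᵍ MvPolynomial.homogeneousSubmodule (Fin (3 + 1)) k)
        (hφ' : HomogeneousIdeal.irrelevant (MvPolynomial.homogeneousSubmodule (Fin (3 + 1)) k) ≤ (HomogeneousIdeal.irrelevant (MvPolynomial.homogeneousSubmodule (Fin (3 + 1)) O)).map φ), (∀ s, φ s = MvPolynomial.map θ s) →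
      ∀ (Ch : ∀ X' : AlgebraicGeometry.Scheme.{0}, (X' ⟶ (AlgebraicGeometry.Proj (MvPolynomial.homogeneousSubmodule (Fin (3 + 1)) O))) → Set X' → Prop),
        (∀ (X' X'' : AlgebraicGeometry.Scheme.{0}) (σ' : X' ⟶ (AlgebraicGeometry.Proj (MvPolynomial.homogeneousSubmodule (Fin (3 + 1)) O))) (S' : Set X') (C : X'.IdealSheafData) (τ : X'' ⟶ X'), Ch X' σ' S' → Literature.AlgebraicGeometry.Resolution.IsBlowup τ C →
          Literature.AlgebraicGeometry.Resolution.Scheme.IsRegular C.subscheme → AlgebraicGeometry.Flat (C.subschemeι ≫ σ' ≫ (AlgebraicGeometry.Proj.toSpecZero (MvPolynomial.homogeneousSubmodule (Fin (3 + 1)) O) ≫ AlgebraicGeometry.Spec.map (CommRingCat.ofHom (algebraMap O (MvPolynomial.homogeneousSubmodule (Fin (3 + 1)) O 0))))) → σ' '' (C.support : Set X') ⊆ {y | ¬ IsGenericPoint y (Set.range (ι ≫ AlgebraicGeometry.Proj.map φ hφ' : H ⟶ (AlgebraicGeometry.Proj (MvPolynomial.homogeneousSubmodule (Fin (3 + 1))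 O))))} →
          (C.support : Set X') ∩ (σ' ≫ (AlgebraicGeometry.Proj.toSpecZero (MvPolynomial.homogeneousSubmodule (Fin (3 + 1)) O) ≫ AlgebraicGeometry.Spec.map (CommRingCat.ofHom (algebraMap O (MvPolynomial.homogeneousSubmodule (Fin (3 + 1)) O 0))))) ⁻¹' {IsLocalRing.closedPoint O} ⊆ S' → Ch X'' (τ ≫ σ') (closure (τ ⁻¹' (S' \ (C.support : Set X'))))) → (∀ (X' : AlgebraicGeometry.Scheme.{0}) (σ' : X' ⟶ (AlgebraicGeometry.Proj (MvPolynomial.homogeneousSubmodule (Fin (3 + 1)) O))) (S' : Set X'), Ch X' σ' S' →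
          Summit.ResolutionOfSingularities.ResolutionOfSingularities.Theses.EquisingularLift.Split.Chain (AlgebraicGeometry.Proj (MvPolynomial.homogeneousSubmodule (Fin (3 + 1)) O)) (Set.range (ι ≫ AlgebraicGeometry.Proj.map φ hφ' : H ⟶ (AlgebraicGeometry.Proj (MvPolynomial.homogeneousSubmodule (Fin (3 + 1)) O)))) X' σ' S') → (Set.range (ι ≫ AlgebraicGeometry.Proj.map φ hφ' : H ⟶ (AlgebraicGeometry.Proj (MvPolynomial.homogeneousSubmodule (Fin (3 + 1)) O)))) ⊆ (AlgebraicGeometry.Proj.toSpecZero (MvPolynomial.homogeneousSubmodule (Fin (3 + 1)) O) ≫ AlgebraicGeometry.Spec.map (CommRingCat.ofHom (algebraMap O (MvPolynomial.homogeneousSubmodule (Fin (3 + 1)) O 0)))) ⁻¹' {IsLocalRing.closedPoint O} → IsIrreducible (Set.range (ι ≫ AlgebraicGeometry.Proj.map φ hφ' : H ⟶ (AlgebraicGeometry.Proj (MvPolynomial.homogeneousSubmodule (Fin (3 + 1)) O)))) → IsClosed (Set.range (ι ≫ AlgebraicGeometry.Proj.map φ hφ' : H ⟶ (AlgebraicGeometry.Proj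 (MvPolynomial.homogeneousSubmodule (Fin (3 + 1)) O)))) →
        AlgebraicGeometry.IsIntegral (AlgebraicGeometry.Proj (MvPolynomial.homogeneousSubmodule (Fin (3 + 1)) O)) → IsLocallyNoetherian (AlgebraicGeometry.Proj (MvPolynomial.homogeneousSubmodule (Fin (3 + 1)) O)) → Literature.AlgebraicGeometry.Resolution.Scheme.IsRegular (AlgebraicGeometry.Proj (MvPolynomial.homogeneousSubmodule (Fin (3 + 1)) O)) → AlgebraicGeometry.IsProper (AlgebraicGeometry.Proj.toSpecZero (MvPolynomial.homogeneousSubmodule (Fin (3 + 1)) O) ≫ AlgebraicGeometry.Spec.map (CommRingCat.ofHom (algebraMap O (MvPolynomial.homogeneousSubmodule (Fin (3 + 1)) O 0)))) → AlgebraicGeometry.SmoothOfRelativeDimension 3 (AlgebraicGeometry.Proj.toSpecZero (MvPolynomial.homogeneousSubmodule (Fin (3 + 1)) O) ≫ AlgebraicGeometry.Spec.map (CommRingCat.ofHom (algebraMap O (MvPolynomial.homogeneousSubmodule (Fin (3 + 1)) O 0)))) →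
      -- the INITIAL stage and the initial host's model
      Ch (AlgebraicGeometry.Proj (MvPolynomial.homogeneousSubmodule (Fin (3 + 1)) O)) (𝟙 (AlgebraicGeometry.Proj (MvPolynomial.homogeneousSubmodule (Fin (3 + 1)) O))) (Set.range (ι ≫ AlgebraicGeometry.Proj.map φ hφ' : H ⟶ (AlgebraicGeometry.Proj (MvPolynomial.homogeneousSubmodule (Fin (3 + 1)) O)))) →
      TCPlus.LetterDatum O (AlgebraicGeometry.Proj (MvPolynomial.homogeneousSubmodule (Fin (3 + 1)) O)) (AlgebraicGeometry.Proj.toSpecZero (MvPolynomial.homogeneousSubmodule (Fin (3 + 1)) O) ≫ AlgebraicGeometry.Spec.map (CommRingCat.ofHom (algebraMap O (MvPolynomial.homogeneousSubmodule (Fin (3 + 1)) O 0)))) (Set.range (ι ≫ AlgebraicGeometry.Proj.map φ hφ' : H ⟶ (AlgebraicGeometry.Proj (MvPolynomial.homogeneousSubmodule (Fin (3 + 1)) O)))) (Literature.AlgebraicGeometry.Motives.projectiveSpace 3 k).left (AlgebraicGeometry.Proj (MvPolynomial.homogeneousSubmodule (Fin (3 + 1)) O)) (𝟙 (AlgebraicGeometry.Proj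 (MvPolynomial.homogeneousSubmodule (Fin (3 + 1)) O))) (AlgebraicGeometry.Proj.map φ hφ' : (Literature.AlgebraicGeometry.Motives.projectiveSpace 3 k).left ⟶ (AlgebraicGeometry.Proj (MvPolynomial.homogeneousSubmodule (Fin (3 + 1)) O))) E₀ →
      ∀ (ℓ : MvPolynomial (Fin (3 + 1)) k) (F₉ : AlgebraicGeometry.Scheme.{0}) (β : F₉ ⟶ (Literature.AlgebraicGeometry.Motives.projectiveSpace 3 k).left) (T₉ E₉ : Set F₉),
        E₀ = {y : (Literature.AlgebraicGeometry.Motives.projectiveSpace 3 k).left | ℓ ∈ (y : ProjectiveSpectrum (MvPolynomial.homogeneousSubmodule (Fin (3 + 1)) k)).asHomogeneousIdeal} →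
        ReachDirectCINoseSigmaPG₂ k 3 (Set.range ι) F₉ β T₉ E₉ →
        ∃ (X₉ : AlgebraicGeometry.Scheme.{0}) (σ₉ : X₉ ⟶ (AlgebraicGeometry.Proj (MvPolynomial.homogeneousSubmodule (Fin (3 + 1)) O))) (S₉ : Set X₉) (j₉ : F₉ ⟶ X₉) (t₉ : F₉ ⟶ AlgebraicGeometry.Spec (.of k)),
          Ch X₉ σ₉ S₉ ∧ AlgebraicGeometry.IsIntegral X₉ ∧ IsLocallyNoetherian X₉ ∧ Literature.AlgebraicGeometry.Resolution.Scheme.IsRegular X₉ ∧ AlgebraicGeometry.IsDominant (σ₉ ≫ (AlgebraicGeometry.Proj.toSpecZero (MvPolynomial.homogeneousSubmodule (Fin (3 + 1)) O) ≫ AlgebraicGeometry.Spec.map (CommRingCat.ofHom (algebraMap O (MvPolynomial.homogeneousSubmodule (Fin (3 + 1)) O 0))))) ∧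
          IsPullback j₉ t₉ (σ₉ ≫ (AlgebraicGeometry.Proj.toSpecZero (MvPolynomial.homogeneousSubmodule (Fin (3 + 1)) O) ≫ AlgebraicGeometry.Spec.map (CommRingCat.ofHom (algebraMap O (MvPolynomial.homogeneousSubmodule (Fin (3 + 1)) O 0))))) (AlgebraicGeometry.Spec.map (CommRingCat.ofHom θ)) ∧ j₉ '' T₉ = S₉ ∧ IsClosed T₉ ∧ IsIrreducible T₉ ∧ AlgebraicGeometry.IsIntegral F₉ ∧
          TCPlus.LetterDatum O (AlgebraicGeometry.Proj (MvPolynomial.homogeneousSubmodule (Fin (3 + 1)) O)) (AlgebraicGeometry.Proj.toSpecZero (MvPolynomial.homogeneousSubmodule (Fin (3 + 1)) O) ≫ AlgebraicGeometry.Spec.map (CommRingCat.ofHom (algebraMap O (MvPolynomial.homogeneousSubmodule (Fin (3 + 1)) O 0)))) (Set.range (ι ≫ AlgebraicGeometry.Proj.map φ hφ' : H ⟶ (AlgebraicGeometry.Proj (MvPolynomial.homogeneousSubmodule (Fin (3 + 1)) O)))) F₉ X₉ σ₉ j₉ E₉) := by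
  classical
  intro O _ _ _ _ _ θ hθ hSL
  letI := MvPolynomial.gradedAlgebra (σ := Fin (3 + 1)) (R := O)
  letI := MvPolynomial.gradedAlgebra (σ := Fin (3 + 1)) (R := k)
  intro φ hφ' hφ Ch hChStep hChSplit hYsp hYirr hYcl hPint hPnoeth hPreg hqprop hqsm hCh₀ h𝓔₀ ℓ F₉ β T₉ E₉ hE hR
  obtain ⟨hE₉, Z, hZ, hZT, hTZ, hZinf, hZdim, hN1, ⟨d₁, d₂, f₁, f₂, hf₁, hf₂, hZeq, hrel, hf₂0, hrad, hJ⟩,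
    F₃, υ', hυ', γ', E', Es', Ns', K', htail, -⟩ := hR
  subst hE₉
  -- THE CENTRE: res-L1-w45b-stub-2's explicit ci smoothing of the reduced complete-intersection trace (host-free: `ℓ`, `E₀` are not read)
  obtain ⟨C₀, hCreg, hCfl, hCj⟩ := Equinodal.ci_trace_smoothing k O θ hθ φ hφ' hφ hPnoeth hPreg hqprop Z hZ hN1
    d₁ d₂ f₁ f₂ hf₁ hf₂ hrel hf₂0 hrad hZeq hJ
  -- the move upstairs: res-L1-w45b-nose-w1's ✓ `directNose_stage_zero_of_model` (stage-0 HEND block from `C₀`, then PHASE 2 of ✓ `hsube_of_suppliers`)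
  exact Equinodal.directNose_stage_zero_of_model_sigmaPG hF k H ι hι hH O θ hθ hSL φ hφ' hφ Ch hChStep hChSplit hYsp hYirr hYcl hPint hPnoeth hPreg hqprop hqsm hCh₀
    Z hZ hZT hTZ hZinf hZdim C₀ hCreg hCfl hCj F₃ υ' hυ' F₉ γ' T₉ E' Es' Ns' K' htail

end Summit.ResolutionOfSingularities.ResolutionOfSingularities.Cruxes.EquisingularLiftNat.Sections.Direct

namespace Summit.ResolutionOfSingularities.ResolutionOfSingularities.Cruxes.EquisingularLiftNat.Sections

/-- ★★ **THE RUNG (R-ν3ΣPG): surfaces `H ⊂ ℙ³_k` whose downstairs nose resolution uses the door «(ν4 ∨ ν3ᵈΣPG) ∨ ν3ᶜⁱΣPG» (the direct doors with the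
Σ-SECTION and (P-ram-Γ) tail rules `TowerSecRoundSigma` / `TowerPRamGamma`, res-type-027 `NoseHypHostedNestEquinodalDirectCISigmaPGBTriplePrime₂`) satisfy EL♮(3)'s conclusion, GIVEN (T-k); the Σ-licence is DISCHARGED INSIDE (variant (b), desk g26-7 (1)) — DERIVED in place from the E-round licence ✓ `ERound.eRoundLift` (same statement as ✓ `SecCurve.secCurveLift k`, whose module is not imported: desk ASK (0) 2026-08-29T11:18Z, its hub olean is lost) and the E-round licence by ★ `ERound.eRoundLift` inside the fifth closure.**  Type = ✓ `nose_ci_rung_three`'s binder convention VERBATIM, ONE token replaced in the blob (lead-2's kit call: `nose_secpg_rung_three p stub_elnat_embeddedCurveLiftFact hp k H ι hι hH hloc hΣPG`).  ONE call of ✓ K5ⁱ with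
`ReachI := (ν4 ∨ ν3ᵈΣ) ∨ ν3ᶜⁱΣ` and `HSUBⁱ := hR.elim (hR.elim HSUBᵉ HSUBᵈΣ) HSUBᶜⁱΣ` — zero engine change.
[OURS · L1 W4.5b · rung of the D13 cut (49th rider or 50th); NOT a statement of the manuscript; EL♮(3) NOT proved] -/
theorem nose_secpg_rung_three (p : ℕ) : EmbeddedCurveLiftFact → p.Prime →
    ∀ (k : Type) [Field k] [CharP k p] [IsAlgClosed k] (H : AlgebraicGeometry.Scheme.{0})
    (ι : H ⟶ (Literature.AlgebraicGeometry.Motives.projectiveSpace 3 k).left),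
    AlgebraicGeometry.IsClosedImmersion ι → AlgebraicGeometry.IsIntegral H →
    (∀ y : (Literature.AlgebraicGeometry.Motives.projectiveSpace 3 k).left,
      ∃ U : (Literature.AlgebraicGeometry.Motives.projectiveSpace 3 k).left.affineOpens,
        y ∈ (U : (Literature.AlgebraicGeometry.Motives.projectiveSpace 3 k).left.Opens) ∧ (ι.ker.ideal U).IsPrincipal) →
    NoseHypHostedNestEquinodalDirectCISigmaPGBTriplePrime₂ k 3 H ι → ELNatConclusionO k 3 H ι := by
  intro hF hp k _ _ _ H ι hι hH hloc hν
  -- the Σ-LICENCE for this `k`, DERIVED from the E-round licence (✓ `ERound.eRoundLift`, p710420: `𝓙 := 𝓘⟨E⟩`, `𝓘 := 𝓘⟨Z⟩`; (N1) unused) —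
  -- a local `have`, so this rung does NOT import `…NatSecCurveLift` (same statement as ✓ `SecCurve.secCurveLift k`; desk ASK (0) 11:18Z: that module's hub olean is lost)
  have hSLk :
    ∀ (O : Type) [CommRing O] [IsDomain O] [IsDiscreteValuationRing O] [IsAdicComplete (maximalIdeal O) O]
        [IsAlgClosed (ResidueField O)] (θ : O →+* k), Function.Surjective θ →
      ∀ {P : Scheme.{0}} (X : Scheme.{0}) (σ : X ⟶ P) (q : P ⟶ Spec (.of O)) (𝓔 : X.IdealSheafData),
        IsIntegral X → IsLocallyNoetherian X → Scheme.IsRegular X → IsProper (σ ≫ q) →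
        (∀ x : X, (stalkIdeal 𝓔 x).IsPrincipal) → 𝓔 ≠ ⊥ →
        Scheme.IsRegular 𝓔.subscheme → Flat (𝓔.subschemeι ≫ σ ≫ q) → IsProper (𝓔.subschemeι ≫ σ ≫ q) →
        ∀ (G : Scheme.{0}) (j : G ⟶ X) (t : G ⟶ Spec (.of k)),
          IsPullback j t (σ ≫ q) (Spec.map (CommRingCat.ofHom θ)) →
          ∀ (E : Set G) (hE : IsClosed E), 𝓔.comap j = vanishingIdeal (⟨E, hE⟩ : Closeds G) →
          ∀ (Z : Set G) (hZ : IsClosed Z), Z ⊆ E →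
            Set.Finite {x : ↥(redSub G Z hZ) | ¬ IsRegularLocalRing ((redSub G Z hZ).presheaf.stalk x)} →
            (∀ z : ↥(redSub G Z hZ), IsClosed ({z} : Set ↥(redSub G Z hZ)) →
              ringKrullDim ((redSub G Z hZ).presheaf.stalk z) = ((1 : ℕ) : WithBot ℕ∞)) →
            (∀ (i : redSub G Z hZ ⟶ redSub G E hE), i ≫ redSubι G E hE = redSubι G Z hZ →
              ∀ z : ↥(redSub G Z hZ), IsClosed ({z} : Set ↥(redSub G Z hZ)) →
                ringKrullDim ((redSub G E hE).presheaf.stalk (i z)) = ((2 : ℕ) : WithBot ℕ∞)) →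
            (∀ z ∈ Z, IsClosed ({z} : Set G) → ∃ f : G.presheaf.stalk z,
              stalkIdeal (vanishingIdeal (⟨Z, hZ⟩ : Closeds G)) z =
                  stalkIdeal (vanishingIdeal (⟨E, hE⟩ : Closeds G)) z ⊔ Ideal.span {f} ∧
                f ∉ stalkIdeal (vanishingIdeal (⟨E, hE⟩ : Closeds G)) z ⊔ (maximalIdeal (G.presheaf.stalk z)) ^ 2) →
            DirStepUnobs G E hE Z hZ →
            ∃ C : X.IdealSheafData, 𝓔 ≤ C ∧ Scheme.IsRegular C.subscheme ∧ Flat (C.subschemeι ≫ σ ≫ q) ∧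
              C.comap j = vanishingIdeal (⟨Z, hZ⟩ : Closeds G) := by
    intro O _ _ _ _ _ θ hθ P X σ q 𝓔 hXi hXn hXr hσq hEpr h0 hEreg hEfl hEprop G j t hsq E hE hEtr Z hZ hZE _hN1 hD1 hD2 hL2 hU
    have hle : vanishingIdeal (⟨E, hE⟩ : Closeds G) ≤ vanishingIdeal (⟨Z, hZ⟩ : Closeds G) :=
      vanishingIdeal_antimono (show (⟨Z, hZ⟩ : Closeds G) ≤ ⟨E, hE⟩ from hZE)
    refine ERound.eRoundLift k O θ hθ X σ q 𝓔 hXi hXn hXr hσq hEpr h0 hEreg hEfl hEprop G j t hsq _ hEtr _ hle hD1 hD2 ?_ hU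
    intro x hx hxc
    rw [Scheme.IdealSheafData.coe_support_vanishingIdeal] at hx
    exact hL2 x hx hxc
  haveI := hι; haveI := hH
  letI := MvPolynomial.gradedAlgebra (σ := Fin (3 + 1)) (R := k)
  obtain ⟨E₀, hE₀, hres⟩ := hν
  -- F4's outer hypothesis on the initial host (the blob's disjunction minus its `¬ range ι ⊆ V₊ ℓ` conjunct); read by JINIT (ν4) and by HSUBᵈ (ν3ᵈ)
  have hE₀' : E₀ = ∅ ∨ ∃ ℓ₀ : MvPolynomial (Fin (3 + 1)) k, ℓ₀.IsHomogeneous 1 ∧ ℓ₀ ≠ 0 ∧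
      E₀ = {y : (Literature.AlgebraicGeometry.Motives.projectiveSpace 3 k).left | ℓ₀ ∈ (y : ProjectiveSpectrum (MvPolynomial.homogeneousSubmodule (Fin (3 + 1)) k)).asHomogeneousIdeal} :=
    hE₀.imp id (fun ⟨ℓ₀, h1, h0, _, h⟩ => ⟨ℓ₀, h1, h0, h⟩)
  -- HINIT by cases on the host; everything else is host-independent
  have HINIT : ∀ (O : Type) [CommRing O] [IsDomain O] [IsDiscreteValuationRing O] [IsAdicComplete (IsLocalRing.maximalIdeal O) O]
      [IsAlgClosed (IsLocalRing.ResidueField O)] (θ : O →+* k), Function.Surjective θ → (letI := MvPolynomial.gradedAlgebra (σ := Fin (3 + 1)) (R := O);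
      letI := MvPolynomial.gradedAlgebra (σ := Fin (3 + 1)) (R := k); ∀ (φ : MvPolynomial.homogeneousSubmodule (Fin (3 + 1)) O →+*ᵍ MvPolynomial.homogeneousSubmodule (Fin (3 + 1)) k)
        (hφ' : HomogeneousIdeal.irrelevant (MvPolynomial.homogeneousSubmodule (Fin (3 + 1)) k) ≤ (HomogeneousIdeal.irrelevant (MvPolynomial.homogeneousSubmodule (Fin (3 + 1)) O)).map φ), (∀ s, φ s = MvPolynomial.map θ s) →
        TCPlus.LetterDatum O (AlgebraicGeometry.Proj (MvPolynomial.homogeneousSubmodule (Fin (3 + 1)) O)) (AlgebraicGeometry.Proj.toSpecZero (MvPolynomial.homogeneousSubmodule (Fin (3 + 1)) O) ≫ AlgebraicGeometry.Spec.map (CommRingCat.ofHom (algebraMap O (MvPolynomial.homogeneousSubmodule (Fin (3 + 1)) O 0)))) (Set.range (ι ≫ AlgebraicGeometry.Proj.map φ hφ' : H ⟶ (AlgebraicGeometry.Proj (MvPolynomial.homogeneousSubmodule (Fin (3 + 1)) O)))) (Literature.AlgebraicGeometry.Motives.projectiveSpace 3 k).left (AlgebraicGeometry.Proj (MvPolynomial.homogeneousSubmodule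 (Fin (3 + 1)) O)) (𝟙 (AlgebraicGeometry.Proj (MvPolynomial.homogeneousSubmodule (Fin (3 + 1)) O))) (AlgebraicGeometry.Proj.map φ hφ' : (Literature.AlgebraicGeometry.Motives.projectiveSpace 3 k).left ⟶ (AlgebraicGeometry.Proj (MvPolynomial.homogeneousSubmodule (Fin (3 + 1)) O))) E₀) := by
    rcases hE₀ with rfl | ⟨ℓ, hℓ1, hℓ0, hHℓ, rfl⟩
    · exact hinit_empty k 3 H ι
    · exact hinit_hyperplane k 2 H ι ℓ hℓ1 hℓ0 hHℓ
  exact target_elnat_of_hostedSubchainResolutionᵢ p hp k 3 H ι hι hH hloc E₀ ReachHostedNoseBTriplePrime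
    (fun ℓ F₉ β T₉ E₉ => (ReachEquinodalPlanarNose₂ k 3 ℓ (Set.range ι) F₉ β T₉ E₉ ∨ ReachDirectPlanarNoseSigmaPG₂ k 3 ℓ (Set.range ι) F₉ β T₉ E₉) ∨
      ReachDirectCINoseSigmaPG₂ k 3 (Set.range ι) F₉ β T₉ E₉)
    HINIT (TCPlus.hpt_seam k 3) (TCPlus.hround_seam k hF) (hsubh_reachHostedNoseBTriplePrime_of_embeddedCurveLiftFact hF k)
    (fun O _ _ _ _ _ θ hθ φ hφ' hφ Ch hChStep hChSplit hYsp hYirr hYcl hPint hPnoeth hPreg hqprop hqsm hCh₀ h𝓔₀ ℓ' F₉ β T₉ E₉ hE₀ hR =>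
      hR.elim (fun hR => hR.elim
        (fun hR => Equinodal.hsube_of_suppliers hF k O θ hθ _ _ _ Ch hChStep hChSplit hYsp hYirr hYcl hPint hPnoeth hPreg hqprop hqsm ℓ' (Set.range ι)
          (Equinodal.RPlus k O θ _ _ _ Ch)
          (Equinodal.jinit_rPlus₀_of_nearNode k H ι hι hH _ hE₀' (Equinodal.nose_regular_near_node k) O θ hθ φ hφ' hφ Ch hChStep hChSplit hYsp hYirr hYcl
            hPint hPnoeth hPreg hqprop hqsm hCh₀ h𝓔₀ ℓ' hE₀)
          (Equinodal.hnode_rPlus k O θ hθ _ _ _ Ch hChStep hChSplit hYsp hYirr hYcl hPint hPnoeth hPreg hqprop hqsm)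
          (Equinodal.hrdz_rPlus k O θ hθ _ _ _ Ch hChStep hChSplit hYsp hYirr hYcl hPint hPnoeth hPreg hqprop hqsm (hF k O θ hθ _ _))
          (Equinodal.hend_rPlus k O θ _ _ _ Ch) F₉ β T₉ E₉ hR)
        (fun hR => Direct.hsubd_sigmaPG_of_smoothing hF k H ι hι hH E₀ hE₀' O θ hθ (hSLk O θ hθ) φ hφ' hφ Ch hChStep hChSplit hYsp hYirr hYcl hPint
          hPnoeth hPreg hqprop hqsm hCh₀ h𝓔₀ ℓ' F₉ β T₉ E₉ hE₀ hR))
        (fun hR => Direct.hsubci_sigmaPG_of_smoothing hF k H ι hι hH E₀ O θ hθ (hSLk O θ hθ) φ hφ' hφ Ch hChStep hChSplit hYsp hYirr hYcl hPint hPnoeth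
          hPreg hqprop hqsm hCh₀ h𝓔₀ ℓ' F₉ β T₉ E₉ hE₀ hR))
    hres

end Summit.ResolutionOfSingularities.ResolutionOfSingularities.Cruxes.EquisingularLiftNat.Sections

end
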